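import Literature.NumberTheory.PAdicHodge.BmaxPlusTransportedReciprocityInputs
import Literature.NumberTheory.PAdicHodge.FormalTateModuleInclusion
import Literature.NumberTheory.PAdicHodge.UnitRootPeriodWitt
import Literature.NumberTheory.GaloisRepresentations.LocalGaloisGroupFrobeniusProofs
import HarnessLib

/-!
# The data of the UNIT-ROOT FRAME at ordinary reduction: `w₀ = θ_∞⁻¹(ι v₀)`, the period `x = LT(v₀)`, the unit-root period `u`, `ρ ≠ χ`

Topic `Literature/NumberTheory/PAdicHodge`; THEOREMS ONLY (line `kato_lever`, crux K★ `stmt-BirchSwinnertonDyer-22226`, stub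
`stub_localFormulaOrdinaryCells`; memo `Cruxes/StarredOptimalManinUnitFiveSeven/Lines/kato-lever-seam-rec-at-cells.md` §17). It turns
* the transported period map `LT : T_pŴ_D → A_max` (`exists_addMonoidHom_logSum_transport`: specification, `ℤ_p`-linearity, `Γ_F`-equivariance),
* a generator `v₀` of `T_pŴ_D` with its character `ρ` (`FormalTateModuleRankOne`), a Hodge line `(A, B, d)`,
* the unit root `α` of `X² − a_p(E₀)X + p` (`απ = p`, `α + π = a_p`), and the ONE non-vanishing input `H₀ := ι(A)f(LT v₀) + ι(B)fφ(LT v₀) ≠ 0`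
into the hypotheses of `UnitRootFrameReciprocity.exists_const_tatePairingPoint_eq_neg_trace_unitRootFrame`:

* ★★ `exists_unitRootFrameData` — `w₀ := θ_∞⁻¹(ι v₀) ≠ 0` with `σ|w₀ = ρ(σ)w₀` (`restrictedTateRep`), `ρ(σ) ≠ 0`; the Dieudonné–Honda relation
  `φ²x − (α+π)φx + px = 0` and `σx = ρ(σ)x` for `x = LT(v₀)`; `θ(H₀) = 0`; a unit `u ∈ A_max` with `φu = αu` (Witt vector over `k̄`,
  `UnitRootPeriodWitt`); and `ρ(σ₁) ≠ χ(σ₁)` for some `σ₁` (an arithmetic Frobenius moves `u` by `α^f ≠ 1`, `a_p² < 4p` by Hasse–Manin).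

HONEST LIMITS: `H₀ ≠ 0` (equivalently `LT(v₀) ≠ 0` and `A + Bπ ≠ 0`), the unit-root input `p ∤ a_p(E₀)` with its root `α`, the formal algebraic
division towers of deep points and the K★ cells are inputs / NOT here; BSD / K★ / [REC-tower] are NOT proved by this file.

## References
* K. Kato, LNM 1553 (1993), Ch. II §1.4, Thm. 1.4.1. [Kato1993LNM1553]
* J. Tate, *p-divisible groups* (1967), §4. [Tate1967]
* J.-P. Serre, *Local Fields* (1979), Ch. II §5–§6. [SerreLocalFields1979]
* P. Colmez, Math. Ann. 292 (1992), §2. [Colmez1992PeriodesAbeliennes]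
* J. H. Silverman, *AEC* (2009), Thm. V.1.1, Prop. VII.2.2. [SilvermanAEC2009]
-/

noncomputable section

open Field Function ValuativeRel WittVector
open scoped Topology

namespace Literature.NumberTheory.PAdicHodge

open Literature.NumberTheory.GaloisRepresentations
open Literature.NumberTheory.GaloisRepresentations.IsNonarchimedeanLocalField
open Literature.NumberTheory.GaloisRepresentations.LubinTate
open Literature.NumberTheory.GaloisCohomology
open Literature.NumberTheory.EllipticCurves
open Literature.NumberTheory.EllipticCurves.FormalGroupChart
open Literature.NumberTheory.PAdicHodge.GaloisContinuity
open Literature.IUT.LogVolume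
open Literature.RingTheory.FormalGroups Literature.AlgebraicGeometry.Resolution
open _root_.WeierstrassCurve

variable {F : Type} [Field F] [ValuativeRel F] [TopologicalSpace F] [IsNonarchimedeanLocalField F] [CharZero F]
  {p : ℕ} [hpp : Fact p.Prime] [Fact (¬ IsUnit (p : integerC F))] [IsAdicComplete (Ideal.span {(p : integerC F)}) (integerC F)]
  [CharP 𝓀[F] p]
  (hp : valuation F p < 1) (D : EisensteinRoot F p hp) [CharZero (CompletedAlgClosure F)]
  (W : WeierstrassCurve (EisensteinRoot.CoeffDisc D)) (E₀ : WeierstrassCurve ℤ)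
  (hWE : W.map (Ideal.Quotient.mk (Ideal.span {EisensteinRoot.CoeffDisc.of D (AdjoinRoot.root D.poly)})) =
    (E₀.map (algebraMap ℤ (EisensteinRoot.CoeffDisc D))).map
      (Ideal.Quotient.mk (Ideal.span {EisensteinRoot.CoeffDisc.of D (AdjoinRoot.root D.poly)})))
  (ψ : EisensteinRoot.CoeffDisc D →+* LTCoeff F) (hψ : ∀ c, algebraMap (LTCoeff F) F (ψ c) = EisensteinRoot.CoeffDisc.toF D c)
  [(AinfTop.curveFO F (W.map ψ)).IsElliptic] [(curveOver (CompletedAlgClosure F) (W.map ψ)).IsElliptic]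
  [(E₀.map (Int.castRingHom ℚ_[p])).IsElliptic] [(E₀.map (Int.castRingHom (ZMod p))).IsElliptic]

omit [Fact (¬ IsUnit (p : integerC F))] [IsAdicComplete (Ideal.span {(p : integerC F)}) (integerC F)] [CharP 𝓀[F] p]
  [CharZero (CompletedAlgClosure F)] [(E₀.map (Int.castRingHom ℚ_[p])).IsElliptic] [(E₀.map (Int.castRingHom (ZMod p))).IsElliptic] in
/-- **`w₀ = θ_∞⁻¹(ι v₀)` is non-zero and `Γ_F` acts on it by `ρ`** (through `restrictedTateRep`): `ι` is injective and equivariant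
(`FormalTateModuleInclusion`), `θ_∞⁻¹` is equivariant along `absGaloisRestrict` (`tateModuleEquiv_symm_smul`). [cite: Tate1967, §4]
[cite: SilvermanAEC2009, III.§7 and Prop. VII.2.2] -/
theorem restrictedTateRep_frameVector (hΔ : IsUnit (W.map ψ).Δ) {v₀ : AinfTop.TatePtO F (W.map ψ) p} (hv₀ : v₀ ≠ 0)
    (ρ : absoluteGaloisGroup F → ℤ_[p]) (hρv : ∀ σ : absoluteGaloisGroup F, σ • v₀ = ρ σ • v₀) :
    (tateModuleEquiv (AinfTop.curveFO F (W.map ψ)) F p).symm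
        ((AinfTop.tateGeomEquivCO F (W.map ψ) p hΔ).symm (tateModuleOfPt (CompletedAlgClosure F) (W.map ψ) p v₀)) ≠ 0 ∧
      (∀ σ, ρ σ ≠ 0) ∧
      ∀ σ : absoluteGaloisGroup F, restrictedTateRep (AinfTop.curveFO F (W.map ψ)) F p σ
        ((tateModuleEquiv (AinfTop.curveFO F (W.map ψ)) F p).symm
          ((AinfTop.tateGeomEquivCO F (W.map ψ) p hΔ).symm (tateModuleOfPt (CompletedAlgClosure F) (W.map ψ) p v₀))) =
        (ρ σ • (tateModuleEquiv (AinfTop.curveFO F (W.map ψ)) F p).symm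
          ((AinfTop.tateGeomEquivCO F (W.map ψ) p hΔ).symm (tateModuleOfPt (CompletedAlgClosure F) (W.map ψ) p v₀)) :
            (AinfTop.curveFO F (W.map ψ)).tateModule p) := by
  refine ⟨fun h0 => hv₀ ?_, fun σ hσ => hv₀ ?_, fun σ => ?_⟩
  · have h1 := (tateModuleEquiv (AinfTop.curveFO F (W.map ψ)) F p).symm.injective (h0.trans (map_zero _).symm)
    exact AinfTop.tateGeomEquivCO_symm_tateModuleOfPt_injective (W.map ψ) hΔ (h1.trans
      (by rw [map_zero, map_zero] : ((AinfTop.tateGeomEquivCO F (W.map ψ) p hΔ).symm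
        (tateModuleOfPt (CompletedAlgClosure F) (W.map ψ) p 0)) = 0).symm)
  · have h1 : σ • v₀ = 0 := by rw [hρv σ, hσ, zero_smul]
    have h2 := congrArg (fun y : AinfTop.TatePtO F (W.map ψ) p => σ⁻¹ • y) h1
    simp only [inv_smul_smul, smul_zero] at h2
    exact h2
  · rw [restrictedTateRep_apply_apply, ← tateModuleEquiv_symm_smul]
    have h : σ • (AinfTop.tateGeomEquivCO F (W.map ψ) p hΔ).symm (tateModuleOfPt (CompletedAlgClosure F) (W.map ψ) p v₀) =
        ρ σ • (AinfTop.tateGeomEquivCO F (W.map ψ) p hΔ).symm (tateModuleOfPt (CompletedAlgClosure F) (W.map ψ) p v₀) := by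
      rw [← AinfTop.tateGeomEquivCO_symm_tateModuleOfPt_smul (W.map ψ) hΔ σ v₀, hρv σ]
      exact (congrArg (AinfTop.tateGeomEquivCO F (W.map ψ) p hΔ).symm
        (LinearMap.map_smul (tateModuleOfPt (CompletedAlgClosure F) (W.map ψ) p) (ρ σ) v₀)).trans
        (LinearEquiv.map_smul (AinfTop.tateGeomEquivCO F (W.map ψ) p hΔ).symm (ρ σ) _)
    exact (congrArg (tateModuleEquiv (AinfTop.curveFO F (W.map ψ)) F p).symm h).trans
      (LinearEquiv.map_smul (tateModuleEquiv (AinfTop.curveFO F (W.map ψ)) F p).symm (ρ σ) _)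

omit [CharP 𝓀[F] p] [(AinfTop.curveFO F (W.map ψ)).IsElliptic] [(curveOver (CompletedAlgClosure F) (W.map ψ)).IsElliptic] in
include hWE hψ in
set_option maxHeartbeats 1600000 in
/-- **The period `x = LT(v₀)` of the frame**: Dieudonné–Honda relation `φ²x − (α+π)φx + px = 0` (`α + π = a_p(E₀)`), `σx = ρ(σ)x`, and the Hodge
combination is `Fil¹`-valued: `θ(ι(A)fx + ι(B)fφx) = 0` (transport of the torsion tower `seqO v₀`, `AinfRamTop.thetaBdR_transportedHodgeCombination_eq_zero_of_torsion`).
[cite: Colmez1992PeriodesAbeliennes, §2] [cite: Katz1981CrystallineDieudonne, Thm. 5.1.4–5.1.5] -/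
theorem framePeriod_honda_gal_theta {N : ℕ} (hN : D.e ≤ N)
    {LT : AinfTop.TatePtO F (W.map ψ) p →+ BmaxPlus F p}
    (hLT : ∀ (τ : AinfTop.TatePtO F (W.map ψ) p) (w : ℕ → (maxNilIdealC F).toIdeal) (hw : ∀ n, AinfTop.mulPC F p E₀ (w (n + 1)) = w n)
        (_ : ∀ n, ‖(((w n : (maxNilIdealC F).toIdeal) : CBall F) : CompletedAlgClosure F) -
      (((AinfTop.seqO (W.map ψ) τ n : (maxNilIdealC F).toIdeal) : CBall F) : CompletedAlgClosure F)‖ ≤ ‖((D.rootC : integerC F) : CompletedAlgClosure F)‖)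
        (z : bmaxZero F p), algebraMap (Ainf (p := p) F) (bmaxZero F p)
        ((AinfTop.of F p).symm (((AinfTop.divisionLiftPt E₀ (surjective_fontaineTheta_integerC hp) w hw).val :
          (AinfTop.nilTheta F p (surjective_fontaineTheta_integerC hp)).toIdeal) : AinfTop F p)) ^ N = (p : bmaxZero F p) * z →
        LT τ = PadicLogSeries.logSum ((algebraMap (Ainf (p := p) F) (bmaxZero F p)).comp zpToAinf) (GaloisContinuity.formalLogNum E₀ p) N
          (algebraMap (Ainf (p := p) F) (bmaxZero F p)
            ((AinfTop.of F p).symm (((AinfTop.divisionLiftPt E₀ (surjective_fontaineTheta_integerC hp) w hw).val :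
              (AinfTop.nilTheta F p (surjective_fontaineTheta_integerC hp)).toIdeal) : AinfTop F p))) z)
    (hsmul : ∀ (c : ℤ_[p]) (τ : AinfTop.TatePtO F (W.map ψ) p), LT (c • τ) = ainfToBmaxPlus F p (zpToAinf c) * LT τ)
    (hgalLT : ∀ (σ : absoluteGaloisGroup F) (τ : AinfTop.TatePtO F (W.map ψ) p), galBmaxPlus σ (LT τ) = LT (σ • τ))
    (v₀ : AinfTop.TatePtO F (W.map ψ) p) (ρ : absoluteGaloisGroup F → ℤ_[p]) (hρv : ∀ σ : absoluteGaloisGroup F, σ • v₀ = ρ σ • v₀)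
    (A B : F) (dHL : ℕ)
    (hHL : ∀ n : ℕ, ‖(p : CompletedAlgClosure F) ^ dHL * PowerSeries.coeff n
        ((W.map ((CBall F).subtype.comp (EisensteinRoot.CoeffDisc.toCBall D))).formalLog -
          PowerSeries.C (algebraMap F (CompletedAlgClosure F) A) * (E₀.map (Int.castRingHom (CompletedAlgClosure F))).formalLog -
          PowerSeries.C (algebraMap F (CompletedAlgClosure F) B) *
            PowerSeries.expand p hpp.out.ne_zero (E₀.map (Int.castRingHom (CompletedAlgClosure F))).formalLog)‖ ≤ 1)
    {α π : ℤ_[p]} (haπ : α + π = ((HasseManin.tr (E₀.map (Int.castRingHom (ZMod p))) : ℤ) : ℤ_[p])) :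
    frobBmaxPlus F p (frobBmaxPlus F p (LT v₀)) - ainfToBmaxPlus F p (zpToAinf (α + π)) * frobBmaxPlus F p (LT v₀) + (p : BmaxPlus F p) * LT v₀ = 0 ∧
      (∀ σ, galBmaxPlus σ (LT v₀) = ainfToBmaxPlus F p (zpToAinf (ρ σ)) * LT v₀) ∧
      thetaBdR (embBdRHom hp (surjective_fontaineTheta_integerC hp) A * bmaxPlusToBdR F p (LT v₀) +
        embBdRHom hp (surjective_fontaineTheta_integerC hp) B * bmaxPlusToBdR F p (frobBmaxPlus F p (LT v₀))) = 0 := by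
  obtain ⟨w, ⟨hw, hwv⟩, -⟩ := exists_unique_transport_seqO D W E₀ hWE ψ hψ v₀
  obtain ⟨z, hz⟩ := exists_witness_transport D W E₀ ψ v₀ hw hwv hN (hθ := surjective_fontaineTheta_integerC hp)
  refine ⟨?_, fun σ => by rw [hgalLT, hρv, hsmul], ?_⟩
  · have hofp : AdicCompletion.of (Ideal.span {(p : bmaxZero F p)}) (bmaxZero F p) (p : bmaxZero F p) = (p : BmaxPlus F p) :=
      map_natCast (algebraMap (bmaxZero F p) (BmaxPlus F p)) p
    rw [haπ, ainfToBmaxPlus_apply, ← hofp]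
    exact frobBmaxPlus_hondaTrace_transport_eq_zero D W E₀ ψ (hθ := surjective_fontaineTheta_integerC hp) hN hLT v₀ hw hwv
  · have hu0 : (((AinfTop.seqO (W.map ψ) v₀ 0 : (maxNilIdealC F).toIdeal) : CBall F) : CompletedAlgClosure F) = 0 := by
      rw [AinfTop.seqO_zero, ZeroMemClass.coe_zero]
    rw [hLT v₀ w hw hwv z hz]
    exact AinfRamTop.thetaBdR_transportedHodgeCombination_eq_zero_of_torsion D (hθ := surjective_fontaineTheta_integerC hp) W E₀ A B dHL
      hHL (AinfTop.seqO (W.map ψ) v₀) w (AinfRamTop.mulPC_seqO W ψ hψ v₀) hu0 hw hwv (D.e_pos.trans_le hN) hz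

omit [CharZero (CompletedAlgClosure F)] [(AinfTop.curveFO F (W.map ψ)).IsElliptic] [(curveOver (CompletedAlgClosure F) (W.map ψ)).IsElliptic]
  [(E₀.map (Int.castRingHom ℚ_[p])).IsElliptic] in
set_option maxHeartbeats 1600000 in
/-- ★★ **The unit-root period and `ρ ≠ χ`.** For the unit root `α` of `X² − a_pX + p` (`p ∤ a_p`, `απ = p`), a Honda `ρ`-isotypic `x` with a
Hodge pair (`θ(H₀) = 0`, `H₀ ≠ 0`): there is a unit `u ∈ A_max` with `φu = αu` (a Witt vector over `k̄`), and `ρ(σ₁) ≠ χ(σ₁)` for some `σ₁`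
(an arithmetic Frobenius `σ₀` moves `u` by `α^f`, `f` the residue degree, and `α^f ≠ 1` since `a_p² < 4p`, Hasse–Manin).
[cite: SerreLocalFields1979, Ch. II §5–§6] [cite: Tate1967, §4] [cite: SilvermanAEC2009, Thm. V.1.1] -/
theorem exists_unitRootPeriod_and_ne_cyclotomic {α π : ℤ_[p]} (hα : ‖α‖ = 1) (hαπ : α * π = p)
    (hαroot : α ^ 2 - ((HasseManin.tr (E₀.map (Int.castRingHom (ZMod p))) : ℤ) : ℤ_[p]) * α + p = 0)
    {x : BmaxPlus F p}
    (hx : frobBmaxPlus F p (frobBmaxPlus F p x) - ainfToBmaxPlus F p (zpToAinf (α + π)) * frobBmaxPlus F p x + (p : BmaxPlus F p) * x = 0)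
    (ρ : absoluteGaloisGroup F → ℤ_[p]) (hρ : ∀ σ, galBmaxPlus σ x = ainfToBmaxPlus F p (zpToAinf (ρ σ)) * x) {A B : F}
    (hfil : thetaBdR (embBdRHom hp (surjective_fontaineTheta_integerC hp) A * bmaxPlusToBdR F p x +
      embBdRHom hp (surjective_fontaineTheta_integerC hp) B * bmaxPlusToBdR F p (frobBmaxPlus F p x)) = 0)
    (hne : embBdRHom hp (surjective_fontaineTheta_integerC hp) A * bmaxPlusToBdR F p x +
      embBdRHom hp (surjective_fontaineTheta_integerC hp) B * bmaxPlusToBdR F p (frobBmaxPlus F p x) ≠ 0) :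
    ∃ u : BmaxPlus F p, IsUnit u ∧ frobBmaxPlus F p u = ainfToBmaxPlus F p (zpToAinf α) * u ∧
      ∃ σ₁, ρ σ₁ ≠ ((GaloisRep.cyclotomicCharacter F p σ₁ : ℤ_[p]ˣ) : ℤ_[p]) := by
  have hp' : p.Prime := Fact.out
  haveI : Fact (¬ IsUnit (p : maxUnramifiedCompletion F)) := ⟨not_isUnit_natCast_completion hp⟩
  haveI : CharP (IsLocalRing.ResidueField (maxUnramifiedCompletion F)) p := charP_residueField_completion
  have hαu : IsUnit α := PadicInt.isUnit_iff.2 hα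
  obtain ⟨w, hw, hφw, hu, hφu⟩ := exists_witt_unitRoot_period (F := F) (p := p) hαu
  refine ⟨_, hu, hφu, ?_⟩
  obtain ⟨σ₀, hσ₀⟩ : ∃ σ₀ : absoluteGaloisGroup F, IsAbsArithFrob σ₀ := exists_isAbsArithFrob_holds (F := F)
  obtain ⟨f, hf, hq⟩ := residueFieldCard_eq_pow_ringChar (F := F)
  rw [ringChar.eq 𝓀[F] p] at hq
  have hsq : ((HasseManin.tr (E₀.map (Int.castRingHom (ZMod p)))) : ℤ) ^ 2 < 4 * p := by
    have h := HasseManin.sq_le_four_mul (fun n => HasseManin.dg_nonneg (E₀.map (Int.castRingHom (ZMod p))) n)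
      (fun n hn => HasseManin.dg_succ_eq_one_of_dg_eq_zero (E₀.map (Int.castRingHom (ZMod p))) hn)
    rw [ZMod.card p] at h
    exact sq_lt_four_mul_of_sq_le hp' h
  have hαf : α ^ f ≠ 1 := unitRoot_pow_ne_one hsq hαroot hf
  have hper := galBmaxPlus_unitRoot_mul (surjective_fontaineTheta_integerC hp) hp hαπ hu hφu hx ρ hρ hfil hne
  exact exists_ne_cyclotomicCharacter_of_period (surjective_fontaineTheta_integerC hp) hσ₀ hq hαf hw hφw ρ hper

end Literature.NumberTheory.PAdicHodge
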